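import Summits.BirchSwinnertonDyer.BirchSwinnertonDyer.Theorems.QuadraticBranchSignedControlNoFiniteSubmodulePlusOfTower
import Summits.BirchSwinnertonDyer.Rank1Residual.Additive.CyclotomicTowerSignedSelmerBaseChange
import HarnessLib

/-!
# Route `QuadraticBranchSignedControl` (rung K8, cell `bsd-potss`): the sign item (R2⁺)
# `NoFiniteSubmodulePlus` (stmt-BirchSwinnertonDyer-19222) from the NAMED Literature fact
# `KitajimaOtsuki2018.mainThm13_plusSelmerDual_noFiniteSubmodule` — modulo Kobayashi's Thm. 2.2
# (tower frame) and ONE tree-internal identification of Selmer conditions (ctrl's bricks (i-c4)+(i-f))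

HONEST FRAMING (cell `bsd-potss`, run/shared/lean/pub/bsd-potss/; FULL-BSD rank ≤ 1 programme,
tranche 1b): CONDITIONAL RESULT with THREE displayed hypotheses, each of a different kind —
(1) `hKO13` = the tree's NAMED Literature fact `KitajimaOtsuki2018.mainThm13_plusSelmerDual_noFiniteSubmodule`
(Kitajima–Otsuki 2018 Main Thm. 1.3, `F = ℚ`, sign `+`, VERBATIM over `ℚ(μ_p)`, `Γ_{ℚ(μ_p)}`-internal;
a published theorem, unproved in the tree); (2) `h22` = the verbatim-shape frame of Kobayashi 2003
Thm. 2.2 ("`X⁺(E/K_∞)` is a finitely generated torsion `Λ`-module", `K_∞ = ℚ(μ_{p^∞})`) on the cell's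
`Γ_ℚ`-internal full dual `TowerSignedSelmerDualData V κ K₀ ℚ_[p] γ 1` — a published theorem whose
`K_∞`-form has no Literature transcription yet (`Kobayashi2003/SignedSelmerTorsion.lean` has the
`ℚ_∞`-form Thm. 1.2 only); (3) `hSel` = NO literature content: the identification, under ctrl's
transport `subgroupH1Iso ∘ res` (`towerTransport`), of the Literature's `Γ_{K₀}`-internal
`Kobayashi2003.signedSelmerInfty (V⁄K₀) κ|_{Γ_{K₀}} 1` with cc-typer-6's `Γ_ℚ`-internal
`towerSignedSelmerInfty V κ K₀ ℚ_[p] 1` — the same group `Sel⁺(E/ℚ(μ_{p^∞}))` typed twice; this is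
EXACTLY the unbuilt bricks (i-c4) (Selmer conditions under `subgroupH1Iso`) + (i-f) (`adicCompletion ↔
ℚ_[p]` model transfer) of ctrl's piece (i), shared with crux 19115 `EtaTransportSigned` (there for
`F = ℚ(√p*)`). NOTHING about the printed theorems is asserted; no definition, no named fact minted, no
`sorry`, axioms standard; item 19222 is NOT closed by this file. WHAT IT RECORDS: modulo tree-internal
plumbing (3), the K8 sign item (R2⁺) IS Kitajima–Otsuki Thm. 1.3 + Kobayashi Thm. 2.2 — every other
step (the `η`-twist transport to `W`, ctrl (D5⁺); the `η`-summand descent, this seat's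
`EtaSignedSelmerDualData.forall_finite_eq_bot_of_tower`; the `Γ_{K₀} ↔ Γ_ℚ` datum transport, this
seat's `TowerSignedSelmerDualData.toKobayashi`) is a tree THEOREM.

References: [KitajimaOtsuki2018] Main Thm. 1.3 (= Thm. 4.8), Remark 1.4 (5), Def. 2.1, §4
(arXiv:1607.03612 pp. 3–4, 6, 18); [Kobayashi2003] Def. 2.1 and Thm. 2.2 (p. 5), §3 p. 5, §4 p. 8.
-/

set_option autoImplicit false
set_option linter.dupNamespace false

noncomputable section

open scoped Classical

namespace Summit.BirchSwinnertonDyer.BirchSwinnertonDyer.Theorems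

open WeierstrassCurve Field Literature.NumberTheory.EllipticCurves
  Literature.NumberTheory.GaloisRepresentations
  ZpExtension Summit.BirchSwinnertonDyer.Rank1Residual.Additive
  Summit.BirchSwinnertonDyer.Rank1Residual.Additive.BaseChange
  Summit.BirchSwinnertonDyer.BirchSwinnertonDyer.Theses.QuadraticBranchSignedControl

/-- **(R2⁺) at a pair `(W, p)` from the NAMED fact Kitajima–Otsuki Main Thm. 1.3 (`F = ℚ`, sign `+`),
Kobayashi's Thm. 2.2 (tower frame) and the Selmer identification `hSel` at `p`.** Proof:
`evenBranchPlusNoFiniteSubmoduleAt_of_kitajimaOtsuki13Tower_of_kobayashi22Tower` with its `hKO`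
tower frame DISCHARGED by `TowerSignedSelmerDualData.forall_finite_eq_bot_of_mainThm13` (the fact
applied to the transported datum `D.toKobayashi`, same module). CONDITIONAL on the three displayed
hypotheses; nothing asserted. [cite: KitajimaOtsuki2018, Main Thm. 1.3 with Def. 2.1 (arXiv:1607.03612 pp. 3, 6)]
[cite: Kobayashi2003, Thm. 2.2 (p. 5), §4 p. 8] -/
theorem evenBranchPlusNoFiniteSubmoduleAt_of_mainThm13_of_selmerIdentification
    (W : WeierstrassCurve ℚ) [W.IsElliptic] [W.IsGloballyMinimal] (p : ℕ) [Fact p.Prime]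
    (hKO13 : KitajimaOtsuki2018.mainThm13_plusSelmerDual_noFiniteSubmodule)
    (h22 : ∀ (K₀ : Type) [Field K₀] [NumberField K₀] [IsCyclotomicExtension {p} ℚ K₀]
        [(galRange (K := ℚ) K₀).Normal],
      ∀ (V : WeierstrassCurve ℚ) [V.IsElliptic] [V.IsGloballyMinimal],
        p ≠ 2 → V.HasGoodReductionAtPrime p → V.frobeniusTrace p = 0 →
      ∀ (κ : ZpExtension ℚ p) (γ : absoluteGaloisGroup ℚ),
        κ.IsCyclotomic → κ.IsTopGenerator γ → γ ∈ galRange (K := ℚ) K₀ →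
      ∀ (D : Summit.BirchSwinnertonDyer.Rank1Residual.Additive.TowerSignedSelmerDualData V κ K₀ ℚ_[p] γ 1),
        Module.Finite (IwasawaAlgebra p) D.X ∧ Module.IsTorsion (IwasawaAlgebra p) D.X)
    (hSel : ∀ (K₀ : Type) [Field K₀] [NumberField K₀] [IsCyclotomicExtension {p} ℚ K₀]
        [(galRange (K := ℚ) K₀).Normal],
      ∀ (V : WeierstrassCurve ℚ) [V.IsElliptic] [V.IsGloballyMinimal],
        p ≠ 2 → V.HasGoodReductionAtPrime p → V.frobeniusTrace p = 0 →
      ∀ (κ : ZpExtension ℚ p), κ.IsCyclotomic →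
        (Kobayashi2003.signedSelmerInfty (V.baseChange K₀)
            (restrictGal K₀ κ (kappa_surjOn_galRange_cyclotomic κ K₀)) 1).map
          (towerTransport K₀ V κ (kappa_surjOn_galRange_cyclotomic κ K₀)) =
        Summit.BirchSwinnertonDyer.Rank1Residual.Additive.towerSignedSelmerInfty V κ K₀ ℚ_[p] 1) :
    EvenBranchPlusNoFiniteSubmoduleAt W p :=
  evenBranchPlusNoFiniteSubmoduleAt_of_kitajimaOtsuki13Tower_of_kobayashi22Tower W p h22
    fun K₀ _ _ _ _ V _ _ hp2 hgood hap κ γ hκ hγ hγK D hfin htor ↦ by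
      haveI := hfin
      exact TowerSignedSelmerDualData.forall_finite_eq_bot_of_mainThm13 K₀ V κ hKO13 hp2 hgood hap
        hκ hγ hγK (hSel K₀ V hp2 hgood hap κ hκ) D htor

/-- **(R2⁺) `NoFiniteSubmodulePlus` (item stmt-BirchSwinnertonDyer-19222) from the NAMED Literature
fact `KitajimaOtsuki2018.mainThm13_plusSelmerDual_noFiniteSubmodule`, every `p ≥ 5`** — modulo (2)
Kobayashi Thm. 2.2 as a frame on the full tower dual and (3) the tree-internal Selmer identification
`hSel` (bricks (i-c4)+(i-f), no literature content). The item is thereby the printed theorem up to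
tree plumbing. CONDITIONAL; closes nothing.
[cite: KitajimaOtsuki2018, Main Thm. 1.3 (= Thm. 4.8) with Def. 2.1 (arXiv:1607.03612 pp. 3, 6)]
[cite: Kobayashi2003, Thm. 2.2 (p. 5), §3 p. 5, §4 p. 8] -/
theorem noFiniteSubmodulePlus_of_mainThm13_of_selmerIdentification
    (hKO13 : KitajimaOtsuki2018.mainThm13_plusSelmerDual_noFiniteSubmodule)
    (h22 : ∀ (p : ℕ) [Fact p.Prime], 5 ≤ p →
      ∀ (K₀ : Type) [Field K₀] [NumberField K₀] [IsCyclotomicExtension {p} ℚ K₀]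
        [(galRange (K := ℚ) K₀).Normal],
      ∀ (V : WeierstrassCurve ℚ) [V.IsElliptic] [V.IsGloballyMinimal],
        p ≠ 2 → V.HasGoodReductionAtPrime p → V.frobeniusTrace p = 0 →
      ∀ (κ : ZpExtension ℚ p) (γ : absoluteGaloisGroup ℚ),
        κ.IsCyclotomic → κ.IsTopGenerator γ → γ ∈ galRange (K := ℚ) K₀ →
      ∀ (D : Summit.BirchSwinnertonDyer.Rank1Residual.Additive.TowerSignedSelmerDualData V κ K₀ ℚ_[p] γ 1),
        Module.Finite (IwasawaAlgebra p) D.X ∧ Module.IsTorsion (IwasawaAlgebra p) D.X)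
    (hSel : ∀ (p : ℕ) [Fact p.Prime], 5 ≤ p →
      ∀ (K₀ : Type) [Field K₀] [NumberField K₀] [IsCyclotomicExtension {p} ℚ K₀]
        [(galRange (K := ℚ) K₀).Normal],
      ∀ (V : WeierstrassCurve ℚ) [V.IsElliptic] [V.IsGloballyMinimal],
        p ≠ 2 → V.HasGoodReductionAtPrime p → V.frobeniusTrace p = 0 →
      ∀ (κ : ZpExtension ℚ p), κ.IsCyclotomic →
        (Kobayashi2003.signedSelmerInfty (V.baseChange K₀)
            (restrictGal K₀ κ (kappa_surjOn_galRange_cyclotomic κ K₀)) 1).map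
          (towerTransport K₀ V κ (kappa_surjOn_galRange_cyclotomic κ K₀)) =
        Summit.BirchSwinnertonDyer.Rank1Residual.Additive.towerSignedSelmerInfty V κ K₀ ℚ_[p] 1) :
    NoFiniteSubmodulePlus :=
  fun W _ _ p _ hp5 ↦ evenBranchPlusNoFiniteSubmoduleAt_of_mainThm13_of_selmerIdentification W p
    hKO13 (h22 p hp5) (hSel p hp5)

end Summit.BirchSwinnertonDyer.BirchSwinnertonDyer.Theorems

end
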